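import Summits.NavierStokesRegularity.NavierStokesRegularity.Theorems.AdaptedFrequencyAdaptedKernelExistsExpMomentPairing
import Summits.NavierStokesRegularity.NavierStokesRegularity.Theorems.AdaptedFrequencyAdaptedKernelExistsExpMomentEnvelope

/-!
# Crux `AdaptedKernelExists` (stmt-NavierStokesRegularity-2956), line `nash-entropy-last-block`:
  STUB `stub_expMoment` — the exponential moment law

For a Type-I divergence-free drift `b` on `[t₀, T)` (jointly smooth, `div b(t) = 0`,
`‖b(t, x)‖ ≤ C/√(T − t)`) and an adapted backward kernel `G` of `∂ₜ + b·∇ − νΔ` on `Ico t₀ T`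
ending at `δ_{x₀}` at time `T` (`Literature.Analysis.FluidPDE.IsAdaptedBackwardKernel`) with some
Gaussian envelope on `Ioo t₀ T`, all exponential moments at interior times are finite and

  `∫ e^{⟨α, x − x₀⟩} G(t, x) dx ≤ exp(ν‖α‖²(T − t) + 2C‖α‖√(T − t))`   (`t ∈ Ioo t₀ T`).

Proof (files `…ExpMomentPairing`, `…ExpMomentEnvelope` and this one). For the cut-off test
functions `φ_R = χ_R(· − x₀) e^{⟨α, · − x₀⟩}` the moments `M_R(s) = ∫ φ_R G(s)` are differentiable
on `Ioo t₀ T` with `M_R′ = ∫ (Dφ_R·b − νΔφ_R) G` (pairing identity: adjoint equation, `div b = 0`,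
integration by parts), whence
`M_R′ ≥ −(C‖α‖/√(T − s) + ν‖α‖²) M_R − (P/√(T − s) + Q) e^{−R²/(4a(T−t))}`
(`expMoment_deriv_lower`: the error lives on `‖x − x₀‖ ≥ R`, where Gaussian beats exponential);
the ODE comparison `expMoment_ode` and the concentration `M_R(s) → φ_R(x₀) = 1` as `s ↑ T` give
`M_R(t) ≤ e^{ν‖α‖²(T−t) + 2C‖α‖√(T−t)} (1 + O(e^{−R²/(4a(T−t))}))` (`expMoment_cutoff_moment_le`),
and `R → ∞` by dominated convergence under the envelope (`stub_expMoment`). The bound is sharp: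
it is attained, up to the sign of `α`, by the Galilean drift (`Negative/GalileanCalibration`).
-/

noncomputable section

open MeasureTheory Set Filter Topology Metric Function
open scoped Laplacian ContDiff RealInnerProductSpace
open Literature.Analysis.FluidPDE

namespace Summit.NavierStokesRegularity.NavierStokesRegularity.Theorems.AdaptedKernelExists.NashEntropyLastBlock

section Main

/-- **The first variation at a fixed time, bounded below.** For the cut-off exponential test
function `φ = χ_R(· − x₀) e^{⟨α, · − x₀⟩}` (`R ≥ 1`, `‖Dχ_R‖ ≤ D₁`, `|Δχ_R| ≤ D₂`), a drift slice
`w` with `‖w‖ ≤ B`, and a continuous slice `Gs ≥ 0` under the Gaussian envelope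
`Gs ≤ K τ^{-3/2} e^{−‖x − x₀‖²/(aτ)}`:
`∫ (Dφ·w − νΔφ) Gs ≥ −(‖α‖B + ν‖α‖²) ∫ φ Gs
  − (D₁(B + 2ν‖α‖) + νD₂) |K| e^{‖α‖²aτ/2} e^{−R²/(4aτ)} (4πa)^{3/2}`
(the pointwise bound `expMoment_test_pointwise_of_norm_le`, whose error term vanishes on
`‖x − x₀‖ < R` and is dominated by the Gaussian `expMoment_envelope_pointwise` elsewhere). -/
theorem expMoment_deriv_lower {ν B K a τ R D₁ D₂ : ℝ} {α x₀ : EuclideanSpace ℝ (Fin 3)}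
    {Gs : EuclideanSpace ℝ (Fin 3) → ℝ} {w : EuclideanSpace ℝ (Fin 3) → EuclideanSpace ℝ (Fin 3)}
    {φ : EuclideanSpace ℝ (Fin 3) → ℝ} (hφ : φ = fun x => cutoff R (x - x₀) * Real.exp ⟪α, x - x₀⟫)
    (hν : 0 ≤ ν) (hB : 0 ≤ B) (ha : 0 < a) (hτ : 0 < τ) (hR : 1 ≤ R) (hD₁ : 0 ≤ D₁)
    (hD₂ : 0 ≤ D₂) (hD₁b : ∀ y, ‖fderiv ℝ (cutoff R : EuclideanSpace ℝ (Fin 3) → ℝ) y‖ ≤ D₁)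
    (hD₂b : ∀ y, |(Δ (cutoff R : EuclideanSpace ℝ (Fin 3) → ℝ)) y| ≤ D₂) (hGc : Continuous Gs)
    (hG0 : ∀ x, 0 ≤ Gs x)
    (hGenv : ∀ x, Gs x ≤ K * τ ^ (-(3:ℝ) / 2) * Real.exp (-(‖x - x₀‖ ^ 2) / (a * τ)))
    (hw : ∀ x, ‖w x‖ ≤ B)
    (hI : Integrable fun x => (fderiv ℝ φ x (w x) - ν * (Δ φ) x) * Gs x) :
    -(‖α‖ * B + ν * ‖α‖ ^ 2) * (∫ x, φ x * Gs x) -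
        (D₁ * (B + 2 * ν * ‖α‖) + ν * D₂) * (|K| * Real.exp (‖α‖ ^ 2 * a * τ / 2) *
          Real.exp (-(R ^ 2) / (4 * a * τ)) * (4 * Real.pi * a) ^ ((3:ℝ) / 2)) ≤
      ∫ x, (fderiv ℝ φ x (w x) - ν * (Δ φ) x) * Gs x := by
  have hR0 : 0 < R := one_pos.trans_le hR
  have hφc : Continuous φ := by
    rw [hφ]; exact (expMoment_test_contDiff R α x₀ (n := 0)).continuous
  have hφcs : HasCompactSupport φ := by
    rw [hφ]; exact expMoment_test_hasCompactSupport hR0 α x₀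
  have hc0 : 0 ≤ D₁ * (B + 2 * ν * ‖α‖) + ν * D₂ := by positivity
  -- the Gaussian majorant of the error term
  obtain ⟨gR, hgR⟩ : ∃ gR : EuclideanSpace ℝ (Fin 3) → ℝ, gR = fun x => |K| * τ ^ (-(3:ℝ) / 2) *
      Real.exp (‖α‖ ^ 2 * a * τ / 2) * Real.exp (-(R ^ 2) / (4 * a * τ)) *
        Real.exp (-(‖x - x₀‖ ^ 2) / (4 * a * τ)) := ⟨_, rfl⟩
  have hgR0 : ∀ x, 0 ≤ gR x := fun x => by rw [hgR]; positivity
  have hgRi : Integrable gR := by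
    rw [hgR]
    exact (expMoment_integrable_gaussian (by positivity : 0 < 4 * a * τ) x₀).const_mul _
  have hgRint : ∫ x, gR x = |K| * Real.exp (‖α‖ ^ 2 * a * τ / 2) *
      Real.exp (-(R ^ 2) / (4 * a * τ)) * (4 * Real.pi * a) ^ ((3:ℝ) / 2) := by
    have heq : ∀ x, gR x =
        (|K| * Real.exp (‖α‖ ^ 2 * a * τ / 2) * Real.exp (-(R ^ 2) / (4 * a * τ))) *
          (τ ^ (-(3:ℝ) / 2) * Real.exp (-(‖x - x₀‖ ^ 2) / (4 * a * τ))) := fun x => by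
      rw [hgR]; ring
    rw [integral_congr_ae (Eventually.of_forall heq), integral_const_mul,
      expMoment_integral_gaussian ha hτ x₀]
  -- the pointwise inequality
  have hpt : ∀ x, -((D₁ * (B + 2 * ν * ‖α‖) + ν * D₂) * gR x) ≤
      (fderiv ℝ φ x (w x) - ν * (Δ φ) x) * Gs x + (‖α‖ * B + ν * ‖α‖ ^ 2) * (φ x * Gs x) := by
    intro x
    have hp := expMoment_test_pointwise_of_norm_le hν R α x₀ x (hw x)
    have hφx : cutoff R (x - x₀) * Real.exp ⟪α, x - x₀⟫ = φ x := by rw [hφ]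
    rw [← hφ, hφx] at hp
    have hp' := mul_le_mul_of_nonneg_right hp (hG0 x)
    have hErr : Real.exp ⟪α, x - x₀⟫ *
        (‖fderiv ℝ (cutoff R : EuclideanSpace ℝ (Fin 3) → ℝ) (x - x₀)‖ * (B + 2 * ν * ‖α‖) +
          ν * |(Δ (cutoff R : EuclideanSpace ℝ (Fin 3) → ℝ)) (x - x₀)|) * Gs x ≤
        (D₁ * (B + 2 * ν * ‖α‖) + ν * D₂) * gR x := by
      by_cases hy : ‖x - x₀‖ < R
      · rw [fderiv_cutoff_eq_zero hR0 hy, laplacian_cutoff_eq_zero hR0 hy]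
        simp only [norm_zero, abs_zero, zero_mul, mul_zero, add_zero]
        exact mul_nonneg hc0 (hgR0 x)
      · have hy' : R ≤ ‖x - x₀‖ := not_lt.1 hy
        have henv := expMoment_envelope_pointwise (α := α) ha hτ hR0.le hy' (hGenv x)
        have hcoef : ‖fderiv ℝ (cutoff R : EuclideanSpace ℝ (Fin 3) → ℝ) (x - x₀)‖ *
            (B + 2 * ν * ‖α‖) + ν * |(Δ (cutoff R : EuclideanSpace ℝ (Fin 3) → ℝ)) (x - x₀)| ≤
              D₁ * (B + 2 * ν * ‖α‖) + ν * D₂ :=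
          add_le_add (mul_le_mul_of_nonneg_right (hD₁b _) (by positivity))
            (mul_le_mul_of_nonneg_left (hD₂b _) hν)
        calc Real.exp ⟪α, x - x₀⟫ *
              (‖fderiv ℝ (cutoff R : EuclideanSpace ℝ (Fin 3) → ℝ) (x - x₀)‖ * (B + 2 * ν * ‖α‖) +
                ν * |(Δ (cutoff R : EuclideanSpace ℝ (Fin 3) → ℝ)) (x - x₀)|) * Gs x
            = (‖fderiv ℝ (cutoff R : EuclideanSpace ℝ (Fin 3) → ℝ) (x - x₀)‖ * (B + 2 * ν * ‖α‖) +
                ν * |(Δ (cutoff R : EuclideanSpace ℝ (Fin 3) → ℝ)) (x - x₀)|) *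
                  (Real.exp ⟪α, x - x₀⟫ * Gs x) := by
              ring
          _ ≤ (D₁ * (B + 2 * ν * ‖α‖) + ν * D₂) * gR x := by
              rw [hgR]
              exact mul_le_mul hcoef henv (mul_nonneg (Real.exp_pos _).le (hG0 x)) hc0
    linarith [hp', hErr]
  -- integrate
  have hφG : Integrable fun x => φ x * Gs x :=
    (hφc.mul hGc).integrable_of_hasCompactSupport hφcs.mul_right
  have hlhs : Integrable fun x => (fderiv ℝ φ x (w x) - ν * (Δ φ) x) * Gs x +
      (‖α‖ * B + ν * ‖α‖ ^ 2) * (φ x * Gs x) := hI.add (hφG.const_mul _)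
  have hrhs : Integrable fun x => -((D₁ * (B + 2 * ν * ‖α‖) + ν * D₂) * gR x) :=
    (hgRi.const_mul _).neg
  have hmono := integral_mono hrhs hlhs hpt
  rw [integral_neg, integral_const_mul, integral_add hI (hφG.const_mul _), integral_const_mul,
    hgRint] at hmono
  linarith

/-- **The cut-off moment bound (fixed `R ≥ 1`).** In the setting of `stub_expMoment` restricted to
the open interval `Ioo t₀ T` (kernel `G`, Type-I divergence-free drift `b`, envelope constants
`K, a`) and for uniform cut-off bounds `‖Dχ_R‖ ≤ D₁`, `|Δχ_R| ≤ D₂`, the cut-off moment at an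
interior time obeys
`∫ χ_R(x − x₀) e^{⟨α, x − x₀⟩} G(t, x) dx ≤ e^{ν‖α‖²h + 2C‖α‖√h} (1 + e^{−R²/(4ah)} (Q h + 2P√h))`,
`h = T − t`, `Λ = |K| e^{‖α‖² a h/2} (4πa)^{3/2}`, `P = D₁CΛ`, `Q = (2ν‖α‖D₁ + νD₂)Λ`: the pairing
identity `expMoment_pairing`, the lower bound `expMoment_deriv_lower` at every `s ∈ [t, T)`
(`T − s ≤ h`), the concentration clause of the kernel, and the ODE comparison `expMoment_ode`. -/
theorem expMoment_cutoff_moment_le {ν C t₀ T K a D₁ D₂ R : ℝ}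
    {b : ℝ → EuclideanSpace ℝ (Fin 3) → EuclideanSpace ℝ (Fin 3)} {x₀ : EuclideanSpace ℝ (Fin 3)}
    {G : ℝ → EuclideanSpace ℝ (Fin 3) → ℝ} (hν : 0 < ν) (hC : 0 ≤ C) (ha : 0 < a)
    (hb : IsSmoothSpaceTimeOn (Ioo t₀ T) b)
    (hdiv : ∀ s ∈ Ioo t₀ T, VectorCalculus.IsDivFree (b s))
    (hrate : ∀ s ∈ Ioo t₀ T, ∀ x, ‖b s x‖ ≤ C / Real.sqrt (T - s))
    (hG : IsAdaptedBackwardKernel ν b (Ioo t₀ T) T x₀ G)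
    (henv : ∀ s ∈ Ioo t₀ T, ∀ x,
      G s x ≤ K * (T - s) ^ (-(3:ℝ) / 2) * Real.exp (-(‖x - x₀‖ ^ 2) / (a * (T - s))))
    (hR : 1 ≤ R) (hD₁ : 0 ≤ D₁) (hD₂ : 0 ≤ D₂)
    (hD₁b : ∀ y, ‖fderiv ℝ (cutoff R : EuclideanSpace ℝ (Fin 3) → ℝ) y‖ ≤ D₁)
    (hD₂b : ∀ y, |(Δ (cutoff R : EuclideanSpace ℝ (Fin 3) → ℝ)) y| ≤ D₂)
    (α : EuclideanSpace ℝ (Fin 3)) {t : ℝ} (ht : t ∈ Ioo t₀ T) :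
    ∫ x, cutoff R (x - x₀) * Real.exp ⟪α, x - x₀⟫ * G t x ≤
      Real.exp (ν * ‖α‖ ^ 2 * (T - t) + 2 * (C * ‖α‖) * Real.sqrt (T - t)) *
        (1 + Real.exp (-(R ^ 2) / (4 * a * (T - t))) *
          ((2 * ν * ‖α‖ * D₁ + ν * D₂) * (|K| * Real.exp (‖α‖ ^ 2 * a * (T - t) / 2) *
              (4 * Real.pi * a) ^ ((3:ℝ) / 2)) * (T - t) +
            2 * (D₁ * C * (|K| * Real.exp (‖α‖ ^ 2 * a * (T - t) / 2) *
              (4 * Real.pi * a) ^ ((3:ℝ) / 2))) * Real.sqrt (T - t))) := by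
  have hR0 : 0 < R := one_pos.trans_le hR
  have htT : t < T := ht.2
  have hh : 0 < T - t := sub_pos.2 htT
  -- the test function
  obtain ⟨φ, hφ⟩ : ∃ φ : EuclideanSpace ℝ (Fin 3) → ℝ,
      φ = fun x => cutoff R (x - x₀) * Real.exp ⟪α, x - x₀⟫ := ⟨_, rfl⟩
  have hφ2 : ContDiff ℝ 2 φ := by rw [hφ]; exact expMoment_test_contDiff R α x₀ (n := 2)
  have hφcs : HasCompactSupport φ := by rw [hφ]; exact expMoment_test_hasCompactSupport hR0 α x₀
  have hφcont : Continuous φ := hφ2.continuous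
  have hφx : ∀ x, cutoff R (x - x₀) * Real.exp ⟪α, x - x₀⟫ = φ x := fun x => by rw [hφ]
  simp_rw [hφx]
  -- the pairing identity on `Ioo t₀ T`
  have hpair : ∀ s ∈ Ioo t₀ T,
      Integrable (fun x => (fderiv ℝ φ x (b s x) - ν * (Δ φ) x) * G s x) ∧
        HasDerivAt (fun r => ∫ x, φ x * G r x)
          (∫ x, (fderiv ℝ φ x (b s x) - ν * (Δ φ) x) * G s x) s :=
    fun s hs => expMoment_pairing isOpen_Ioo hb hdiv hG hφ2 hφcs hs
  -- constants
  set Λ := |K| * Real.exp (‖α‖ ^ 2 * a * (T - t) / 2) * (4 * Real.pi * a) ^ ((3:ℝ) / 2) with hΛ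
  set P := D₁ * C * Λ with hP
  set Q := (2 * ν * ‖α‖ * D₁ + ν * D₂) * Λ with hQ
  set ε := Real.exp (-(R ^ 2) / (4 * a * (T - t))) with hε
  have hΛ0 : 0 ≤ Λ := by positivity
  have hP0 : 0 ≤ P := by positivity
  have hQ0 : 0 ≤ Q := by positivity
  have hε0 : 0 ≤ ε := (Real.exp_pos _).le
  refine expMoment_ode (M := fun s => ∫ x, φ x * G s x)
    (m := fun s => ∫ x, (fderiv ℝ φ x (b s x) - ν * (Δ φ) x) * G s x) htT
    (by positivity : 0 ≤ C * ‖α‖) (by positivity : 0 ≤ ν * ‖α‖ ^ 2) hP0 hQ0 hε0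
    (fun s hs => (hpair s ⟨ht.1.trans_le hs.1, hs.2⟩).2) (fun s hs => ?_) ?_
  · -- the differential inequality at `s ∈ [t, T)`
    have hsS : s ∈ Ioo t₀ T := ⟨ht.1.trans_le hs.1, hs.2⟩
    have hτ : 0 < T - s := sub_pos.2 hs.2
    have hτh : T - s ≤ T - t := by linarith [hs.1]
    have hBw : 0 ≤ C / Real.sqrt (T - s) := by positivity
    have hGc : Continuous (G s) := (hG.contDiff_slice hsS).continuous
    have hG0 : ∀ x, 0 ≤ G s x := fun x => (hG.pos s hsS x).le
    have key := expMoment_deriv_lower hφ hν.le hBw ha hτ hR hD₁ hD₂ hD₁b hD₂b hGc hG0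
      (henv s hsS) (hrate s hsS) (hpair s hsS).1
    rw [show ‖α‖ * (C / Real.sqrt (T - s)) = C * ‖α‖ / Real.sqrt (T - s) by ring] at key
    have e1 : Real.exp (‖α‖ ^ 2 * a * (T - s) / 2) ≤ Real.exp (‖α‖ ^ 2 * a * (T - t) / 2) :=
      Real.exp_le_exp.2 (by gcongr)
    have e2 : Real.exp (-(R ^ 2) / (4 * a * (T - s))) ≤ ε := by
      refine Real.exp_le_exp.2 ?_
      rw [neg_div, neg_div, neg_le_neg_iff]
      exact div_le_div_of_nonneg_left (sq_nonneg R) (by positivity) (by gcongr)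
    have hc0 : 0 ≤ D₁ * (C / Real.sqrt (T - s) + 2 * ν * ‖α‖) + ν * D₂ := by positivity
    have step : (D₁ * (C / Real.sqrt (T - s) + 2 * ν * ‖α‖) + ν * D₂) *
        (|K| * Real.exp (‖α‖ ^ 2 * a * (T - s) / 2) * Real.exp (-(R ^ 2) / (4 * a * (T - s))) *
          (4 * Real.pi * a) ^ ((3:ℝ) / 2)) ≤
        (D₁ * (C / Real.sqrt (T - s) + 2 * ν * ‖α‖) + ν * D₂) *
          (|K| * Real.exp (‖α‖ ^ 2 * a * (T - t) / 2) * ε * (4 * Real.pi * a) ^ ((3:ℝ) / 2)) := by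
      gcongr
    have ident : (D₁ * (C / Real.sqrt (T - s) + 2 * ν * ‖α‖) + ν * D₂) *
        (|K| * Real.exp (‖α‖ ^ 2 * a * (T - t) / 2) * ε * (4 * Real.pi * a) ^ ((3:ℝ) / 2)) =
        (P / Real.sqrt (T - s) + Q) * ε := by
      rw [hP, hQ, hΛ]; ring
    beta_reduce
    linarith [key, step, ident]
  · -- concentration at the pole: `M(s) → φ(x₀) = 1`
    obtain ⟨Mφ, hMφ⟩ := hφcont.bounded_above_of_compact_support hφcs
    have hlim := hG.tendsto_integral_mul φ hφcont
      ⟨Mφ, fun x => by rw [← Real.norm_eq_abs]; exact hMφ x⟩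
    have h1 : φ x₀ = 1 := by rw [hφ]; exact expMoment_test_center hR0 α x₀
    rw [h1] at hlim
    beta_reduce
    exact hlim

end Main

/-! ### The stub -/

/-- **STUB `stub_expMoment` — the exponential moment law (the displacement lever of the line
`nash-entropy-last-block`).** For a Type-I divergence-free drift `b` on `[t₀, T)` (jointly smooth
on `Ico t₀ T × ℝ³`, `div b(t) = 0`, `‖b(t, x)‖ ≤ C/√(T − t)`) and an adapted backward kernel `G` of
`∂ₜ + b·∇ − νΔ` on `Ico t₀ T` ending at `δ_{x₀}` at time `T` with some Gaussian envelope
`G ≤ K (T − t)^{-3/2} e^{−‖x − x₀‖²/(a(T − t))}` on `Ioo t₀ T`, all exponential moments at interior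
times are finite and `∫ e^{⟨α, x − x₀⟩} G(t, x) dx ≤ exp(ν‖α‖²(T − t) + 2C‖α‖√(T − t))`.
Integrability from the envelope (Gaussian beats exponential); the bound from
`expMoment_cutoff_moment_le` along `R = n + 1 → ∞` (dominated convergence under the envelope,
`e^{−R²/(4a(T−t))} → 0`). Sharp: attained up to the sign of `α` by the Galilean drift. -/
theorem stub_expMoment :
    ∀ (ν C t₀ T : ℝ) (b : ℝ → EuclideanSpace ℝ (Fin 3) → EuclideanSpace ℝ (Fin 3))
      (x₀ : EuclideanSpace ℝ (Fin 3)) (G : ℝ → EuclideanSpace ℝ (Fin 3) → ℝ),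
      0 < ν → 0 ≤ C → t₀ < T →
      IsSmoothSpaceTimeOn (Ico t₀ T) b →
      (∀ t ∈ Ico t₀ T, VectorCalculus.IsDivFree (b t)) →
      (∀ t ∈ Ico t₀ T, ∀ x, ‖b t x‖ ≤ C / Real.sqrt (T - t)) →
      IsAdaptedBackwardKernel ν b (Ico t₀ T) T x₀ G →
      (∃ K a : ℝ, 0 < a ∧ ∀ t ∈ Ioo t₀ T, ∀ x,
        G t x ≤ K * (T - t) ^ (-(3:ℝ) / 2) * Real.exp (-(‖x - x₀‖ ^ 2) / (a * (T - t)))) →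
      ∀ (α : EuclideanSpace ℝ (Fin 3)), ∀ t ∈ Ioo t₀ T,
        Integrable (fun x => Real.exp (inner ℝ α (x - x₀)) * G t x) ∧
        ∫ x, Real.exp (inner ℝ α (x - x₀)) * G t x ≤
          Real.exp (ν * ‖α‖ ^ 2 * (T - t) + 2 * C * ‖α‖ * Real.sqrt (T - t)) := by
  intro ν C t₀ T b x₀ G hν hC _ hb hdiv hrate hG henv α t ht
  obtain ⟨K, a, ha, henv⟩ := henv
  have htT : t < T := ht.2
  have hh : 0 < T - t := sub_pos.2 htT
  -- restriction to the open interval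
  have hGo : IsAdaptedBackwardKernel ν b (Ioo t₀ T) T x₀ G :=
    hG.mono Ioo_subset_Ico_self (uniqueDiffOn_Ioo t₀ T)
  have hbo : IsSmoothSpaceTimeOn (Ioo t₀ T) b := hb.mono Ioo_subset_Ico_self
  have hdivo : ∀ s ∈ Ioo t₀ T, VectorCalculus.IsDivFree (b s) := fun s hs =>
    hdiv s (Ioo_subset_Ico_self hs)
  have hrateo : ∀ s ∈ Ioo t₀ T, ∀ x, ‖b s x‖ ≤ C / Real.sqrt (T - s) := fun s hs =>
    hrate s (Ioo_subset_Ico_self hs)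
  have hGc : Continuous (G t) := (hGo.contDiff_slice ht).continuous
  have hG0 : ∀ x, 0 ≤ G t x := fun x => (hGo.pos t ht x).le
  -- the integrable Gaussian majorant
  obtain ⟨F, hF⟩ : ∃ F : EuclideanSpace ℝ (Fin 3) → ℝ, F = fun x =>
      |K| * (T - t) ^ (-(3:ℝ) / 2) * Real.exp (‖α‖ ^ 2 * a * (T - t) / 2) *
        Real.exp (-((0:ℝ) ^ 2) / (4 * a * (T - t))) *
          Real.exp (-(‖x - x₀‖ ^ 2) / (4 * a * (T - t))) := ⟨_, rfl⟩
  have hFi : Integrable F := by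
    rw [hF]
    exact (expMoment_integrable_gaussian (by positivity : 0 < 4 * a * (T - t)) x₀).const_mul _
  have hbound : ∀ x, Real.exp ⟪α, x - x₀⟫ * G t x ≤ F x := fun x => by
    rw [hF]
    exact expMoment_envelope_pointwise ha hh le_rfl (norm_nonneg _) (henv t ht x)
  have hint : Integrable (fun x => Real.exp ⟪α, x - x₀⟫ * G t x) := by
    refine hFi.mono'
      (((expMoment_contDiff_exp_inner α x₀ (n := 0)).continuous.mul hGc).aestronglyMeasurable)
      (Eventually.of_forall fun x => ?_)
    rw [Real.norm_eq_abs, abs_of_nonneg (mul_nonneg (Real.exp_pos _).le (hG0 x))]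
    exact hbound x
  refine ⟨hint, ?_⟩
  -- uniform cut-off bounds along `R = n + 1`
  obtain ⟨D₁, hD₁0, hD₁⟩ := exists_norm_fderiv_cutoff_le (E := EuclideanSpace ℝ (Fin 3))
  obtain ⟨D₂, hD₂0, hD₂⟩ := exists_abs_laplacian_cutoff_le (E := EuclideanSpace ℝ (Fin 3))
  have hn1 : ∀ n : ℕ, (1:ℝ) ≤ (n:ℝ) + 1 := fun n => by
    have := n.cast_nonneg (α := ℝ); linarith
  have hD₁b : ∀ (n : ℕ) (y : EuclideanSpace ℝ (Fin 3)),
      ‖fderiv ℝ (cutoff ((n:ℝ) + 1) : EuclideanSpace ℝ (Fin 3) → ℝ) y‖ ≤ D₁ := fun n y =>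
    (hD₁ _ (by linarith [hn1 n]) y).trans (div_le_self hD₁0 (hn1 n))
  have hD₂b : ∀ (n : ℕ) (y : EuclideanSpace ℝ (Fin 3)),
      |(Δ (cutoff ((n:ℝ) + 1) : EuclideanSpace ℝ (Fin 3) → ℝ)) y| ≤ D₂ := fun n y =>
    (hD₂ _ (by linarith [hn1 n]) y).trans (div_le_self hD₂0 (one_le_pow₀ (hn1 n)))
  -- the cut-off moment bounds
  obtain ⟨c₀, hc₀⟩ : ∃ c₀ : ℝ, c₀ =
      (2 * ν * ‖α‖ * D₁ + ν * D₂) * (|K| * Real.exp (‖α‖ ^ 2 * a * (T - t) / 2) *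
          (4 * Real.pi * a) ^ ((3:ℝ) / 2)) * (T - t) +
        2 * (D₁ * C * (|K| * Real.exp (‖α‖ ^ 2 * a * (T - t) / 2) *
          (4 * Real.pi * a) ^ ((3:ℝ) / 2))) * Real.sqrt (T - t) := ⟨_, rfl⟩
  have hbn : ∀ n : ℕ,
      ∫ x, cutoff ((n:ℝ) + 1) (x - x₀) * Real.exp ⟪α, x - x₀⟫ * G t x ≤
        Real.exp (ν * ‖α‖ ^ 2 * (T - t) + 2 * (C * ‖α‖) * Real.sqrt (T - t)) *
          (1 + Real.exp (-(((n:ℝ) + 1) ^ 2) / (4 * a * (T - t))) * c₀) := fun n => by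
    rw [hc₀]
    exact expMoment_cutoff_moment_le hν hC ha hbo hdivo hrateo hGo henv (hn1 n) hD₁0 hD₂0
      (hD₁b n) (hD₂b n) α ht
  -- `R → ∞`: dominated convergence on the left, `e^{-R²/(4ah)} → 0` on the right
  have hlimM : Tendsto (fun n : ℕ => ∫ x, cutoff ((n:ℝ) + 1) (x - x₀) * Real.exp ⟪α, x - x₀⟫ *
      G t x) atTop (𝓝 (∫ x, Real.exp ⟪α, x - x₀⟫ * G t x)) := by
    refine tendsto_integral_of_dominated_convergence F (fun n => ?_) hFi (fun n => ?_) ?_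
    · exact ((expMoment_test_contDiff ((n:ℝ) + 1) α x₀ (n := 0)).continuous.mul
        hGc).aestronglyMeasurable
    · refine Eventually.of_forall fun x => ?_
      have h01 := expMoment_test_nonneg_le ((n:ℝ) + 1) α x₀ x
      rw [Real.norm_eq_abs, abs_of_nonneg (mul_nonneg h01.1 (hG0 x))]
      exact (mul_le_mul_of_nonneg_right h01.2 (hG0 x)).trans (hbound x)
    · refine Eventually.of_forall fun x => ?_
      have := ((tendsto_cutoff_natCast_add_one (x - x₀)).mul_const
        (Real.exp ⟪α, x - x₀⟫)).mul_const (G t x)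
      rwa [one_mul] at this
  have hlimε : Tendsto (fun n : ℕ => Real.exp (-(((n:ℝ) + 1) ^ 2) / (4 * a * (T - t))))
      atTop (𝓝 0) := by
    have h1 : Tendsto (fun n : ℕ => ((n:ℝ) + 1) ^ 2 / (4 * a * (T - t))) atTop atTop := by
      refine Tendsto.atTop_div_const (by positivity) ?_
      exact (tendsto_pow_atTop two_ne_zero).comp
        (tendsto_natCast_atTop_atTop.atTop_add tendsto_const_nhds)
    refine (Real.tendsto_exp_atBot.comp (tendsto_neg_atTop_atBot.comp h1)).congr fun n => ?_
    simp only [Function.comp_apply, neg_div]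
  have hlimR : Tendsto (fun n : ℕ =>
      Real.exp (ν * ‖α‖ ^ 2 * (T - t) + 2 * (C * ‖α‖) * Real.sqrt (T - t)) *
        (1 + Real.exp (-(((n:ℝ) + 1) ^ 2) / (4 * a * (T - t))) * c₀)) atTop
      (𝓝 (Real.exp (ν * ‖α‖ ^ 2 * (T - t) + 2 * (C * ‖α‖) * Real.sqrt (T - t)) *
        (1 + 0 * c₀))) :=
    tendsto_const_nhds.mul (tendsto_const_nhds.add (hlimε.mul_const c₀))
  have hfin := le_of_tendsto_of_tendsto' hlimM hlimR hbn
  rw [zero_mul, add_zero, mul_one] at hfin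
  calc ∫ x, Real.exp ⟪α, x - x₀⟫ * G t x
      ≤ Real.exp (ν * ‖α‖ ^ 2 * (T - t) + 2 * (C * ‖α‖) * Real.sqrt (T - t)) := hfin
    _ = Real.exp (ν * ‖α‖ ^ 2 * (T - t) + 2 * C * ‖α‖ * Real.sqrt (T - t)) := by
        congr 1; ring

end Summit.NavierStokesRegularity.NavierStokesRegularity.Theorems.AdaptedKernelExists.NashEntropyLastBlock

end
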